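import Mathlib
import Summits.CriticalPhenomena.SAWScalingLimit.Theorems.SAWDevelopingMapNoFoldBoundWalledClasses
import Literature.Probability.RandomPlanarGeometry.HexMidEdgeSAWDoors

/-!
# Port renewal off the source: cutting and gluing walks at the first visit to a vertex

Helper file (walk surgery) for the crux `NoFoldBound` (stmt-CriticalPhenomena-8296) of the route
`SAWDevelopingMap` (sub-problem `SAWScalingLimit` of `CriticalPhenomena`), line `Ideator3Sketch`,
stub `stub_portRenewal` (the renewal identity for the SAW parafermionic observable at a vertex
off the source, file `SAWDevelopingMapNoFoldBoundPortRenewal.lean`).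

Setting (Duminil-Copin–Smirnov 2012, §1–§2; walks between mid-edges of the hexagonal lattice `ℍ`
as vertex lists, `HexMidEdgeSAW`): a finite vertex set `Λ`, a source mid-edge `a`, a vertex
`v ∈ Λ` with `v ∉ a`, and two neighbours `w, w₀` of `v` (possibly equal).  A FIRST ARRIVAL at `v`
through the port `w` is a walk `γ` from `a` to the mid-edge `{v, w}` avoiding `v` (it ends at
`w`); a CONTINUATION of `γ` is a walk `η` of the slit domain `Λ ∖ γ` from the door `{w, v}`
(`w ∈ γ` lies outside the slit domain, `v` inside) to `{v, w₀}`.  This is the first-entrance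
cut-and-glue surgery of self-avoiding walks (Madras–Slade 1993, §3–§4) at the vertex `v`:

* `glue_subset`, …, `glue_edges_nodup` — the concatenation `γ ++ η` satisfies the axioms of a
  walk of `Λ` from `a` to `{v, w₀}`; `weight_eq_of_verts_eq_append` — its weight is
  `weight γ · weight η` (lengths add; windings add because the last half-segment
  `c(w) → mid{v,w}` of `γ` and the first half-segment `mid{w,v} → c(v)` of `η` are the two halves
  of the segment `c(w) → c(v)`; a trivial `η` forces `w = w₀`);
* `spec_of_verts_eq_append`, `takeWhile_glue` — the glued walk avoids `v` (trivial `η`) or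
  passes `w` right before `v`, and `γ` is its longest prefix avoiding `v` (injectivity);
* `exists_trivCont` — the trivial continuation; `exists_cut` — conversely a walk from `a` to
  `{v, w₀}` passing `w` right before `v` splits there into a first arrival through `w` and a
  continuation;
* `exists_infix_of_mem`, `eq_of_infix_of_infix` — a walk through `v` enters `v` from a unique
  neighbour;
* `helper_portRenewalWalks` — gluing and cutting packaged as the registered sub-goal.

No simple connectivity and no hypothesis on `a` (beyond `v ∉ a`) is used.
-/

noncomputable section

open scoped BigOperators
open Literature.Probability.LatticeModels Literature.Probability.RandomPlanarGeometry.SAW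

namespace Summit.CriticalPhenomena.SAWScalingLimit.Theorems.SAWDevelopingMapNoFoldBound

namespace PortRenewal

variable {Λ : Finset HexVertex} {a : Sym2 HexVertex} {v w w₀ : HexVertex}

/-! ### List lemmas -/

/-- The longest prefix avoiding `v` of a list `L ++ v :: R` with `v ∉ L` is `L`. -/
theorem takeWhile_eq_of_notMem {l L R : List HexVertex} (hl : l = L ++ v :: R) (hv : v ∉ L) :
    l.takeWhile (fun y => !decide (y = v)) = L := by
  rw [hl, List.takeWhile_append_of_pos (fun y hy => by simpa using ne_of_mem_of_not_mem hy hv),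
    List.takeWhile_cons_of_neg (by simp), List.append_nil]

/-- In a duplicate-free list the entry before `v` is unique. -/
theorem eq_of_infix_of_infix {l : List HexVertex} (hl : l.Nodup) {p q : HexVertex}
    (hp : [p, v] <:+: l) (hq : [q, v] <:+: l) : p = q := by
  obtain ⟨s, t, rfl⟩ := hp
  obtain ⟨s', t', h⟩ := hq
  have e₁ : s ++ [p, v] ++ t = (s ++ [p]) ++ v :: t := by simp
  have e₂ : s' ++ [q, v] ++ t' = (s' ++ [q]) ++ v :: t' := by simp
  have n₁ : v ∉ s ++ [p] := fun hv =>
    (List.nodup_append.1 (e₁ ▸ hl)).2.2 v hv v List.mem_cons_self rfl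
  have hl₂ : ((s' ++ [q]) ++ v :: t').Nodup := by rw [← e₂, h]; exact hl
  have n₂ : v ∉ s' ++ [q] := fun hv => (List.nodup_append.1 hl₂).2.2 v hv v List.mem_cons_self rfl
  have t₁ := takeWhile_eq_of_notMem e₁ n₁
  have t₂ := takeWhile_eq_of_notMem (h.symm.trans e₂) n₂
  have := t₁.symm.trans t₂
  simpa using congrArg List.getLast? this

/-! ### First arrivals and their continuations in the slit domain -/

/-- The door `{w, v}` of the slit domain `Λ ∖ L` (`v ∈ Λ`, `v ∉ L`, `v ∼ w`) is one of its
mid-edges. -/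
theorem door_mem_hexDomainMidEdges {L : List HexVertex} (hv : v ∈ Λ) (hvL : v ∉ L)
    (hvw : hexGraph.Adj v w) : s(w, v) ∈ hexDomainMidEdges (Λ \ L.toFinset) :=
  ⟨(SimpleGraph.mem_edgeSet hexGraph).2 hvw.symm, v, Sym2.mem_mk_right w v,
    Finset.mem_sdiff.2 ⟨hv, fun h => hvL (List.mem_toFinset.1 h)⟩⟩

/-- The vertices of a continuation (a walk of the slit domain `Λ ∖ γ`) lie in `Λ` and off `γ`. -/
theorem cont_mem (γ : HexMidEdgeSAW Λ a s(v, w))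
    (η : HexMidEdgeSAW (Λ \ γ.verts.toFinset) s(w, v) s(v, w₀)) :
    ∀ y ∈ η.verts, y ∈ Λ ∧ y ∉ γ.verts := fun y hy => by
  have h := Finset.mem_sdiff.1 (η.subset y hy)
  exact ⟨h.1, fun h' => h.2 (List.mem_toFinset.2 h')⟩

/-- A nontrivial continuation from the door `{w, v}` of `Λ ∖ γ` (`w` the last vertex of the first
arrival `γ`) starts at `v`. -/
theorem cont_eq_cons (γ : HexMidEdgeSAW Λ a s(v, w)) (hva : v ∉ a) (hvγ : v ∉ γ.verts)
    (η : HexMidEdgeSAW (Λ \ γ.verts.toFinset) s(w, v) s(v, w₀)) (hne : η.verts ≠ []) :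
    ∃ t, η.verts = v :: t := by
  obtain ⟨y, t, hyt⟩ := List.exists_cons_of_ne_nil hne
  have hy : y ∈ s(w, v) := η.head_mem y (by rw [hyt]; rfl)
  have hyγ : y ∉ γ.verts := (cont_mem γ η y (by rw [hyt]; exact List.mem_cons_self)).2
  rcases Sym2.mem_iff.1 hy with h | h
  · exact absurd (List.mem_of_getLast? (arrival_getLast?_eq hva γ hvγ)) (h ▸ hyγ)
  · exact ⟨t, by rw [hyt, h]⟩

/-- A trivial continuation from the door `{w, v}` to `{v, w₀}` forces `w = w₀`. -/
theorem eq_of_cont_eq_nil (γ : HexMidEdgeSAW Λ a s(v, w)) (hvw : hexGraph.Adj v w)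
    (η : HexMidEdgeSAW (Λ \ γ.verts.toFinset) s(w, v) s(v, w₀)) (hη : η.verts = []) : w = w₀ := by
  rcases Sym2.eq_iff.1 (η.eq_of_nil hη) with ⟨h, -⟩ | ⟨h, -⟩
  · exact absurd h.symm hvw.ne
  · exact h

/-- The trivial continuation: the empty walk of `Λ ∖ γ` from the door `{w, v}` to the same
mid-edge `{v, w}`. -/
theorem exists_trivCont (γ : HexMidEdgeSAW Λ a s(v, w)) (hv : v ∈ Λ) (hvγ : v ∉ γ.verts)
    (hvw : hexGraph.Adj v w) :
    ∃ η : HexMidEdgeSAW (Λ \ γ.verts.toFinset) s(w, v) s(v, w), η.verts = [] :=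
  ⟨⟨[], by simp, List.nodup_nil, List.isChain_nil, by simp, by simp, fun _ => Sym2.eq_swap,
    fun h => (h rfl).elim, door_mem_hexDomainMidEdges hv hvγ hvw⟩, rfl⟩

/-! ### Gluing a first arrival and a continuation -/

section Glue

variable (γ : HexMidEdgeSAW Λ a s(v, w)) (hva : v ∉ a) (hvγ : v ∉ γ.verts)
  (hvw : hexGraph.Adj v w) (η : HexMidEdgeSAW (Λ \ γ.verts.toFinset) s(w, v) s(v, w₀))

/-- Gluing: the vertices stay in `Λ`. -/
theorem glue_subset : ∀ y ∈ γ.verts ++ η.verts, y ∈ Λ := by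
  intro y hy
  rcases List.mem_append.1 hy with hy | hy
  · exact γ.subset y hy
  · exact (cont_mem γ η y hy).1

/-- Gluing: no vertex is repeated (the continuation avoids `γ`). -/
theorem glue_nodup : (γ.verts ++ η.verts).Nodup :=
  List.nodup_append.2 ⟨γ.nodup, η.nodup, fun _ hx y hy hxy => (cont_mem γ η y hy).2 (hxy ▸ hx)⟩

include hva hvγ hvw in
/-- Gluing: consecutive vertices stay adjacent (`w ∼ v` at the junction). -/
theorem glue_isChain : (γ.verts ++ η.verts).IsChain hexGraph.Adj :=
  List.IsChain.append γ.isChain η.isChain fun x hx y hy => by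
    rw [Option.mem_def, arrival_getLast?_eq hva γ hvγ, Option.some.injEq] at hx
    have hne : η.verts ≠ [] := by rintro h; simp [h] at hy
    obtain ⟨t, ht⟩ := cont_eq_cons γ hva hvγ η hne
    rw [Option.mem_def, ht, List.head?_cons, Option.some.injEq] at hy
    rw [← hx, ← hy]
    exact hvw.symm

include hva in
/-- Gluing: the first vertex is unchanged. -/
theorem glue_head_mem : ∀ y, (γ.verts ++ η.verts).head? = some y → y ∈ a := fun y hy =>
  γ.head_mem y (by rwa [List.head?_append_of_ne_nil _ (arrival_verts_ne_nil hva γ)] at hy)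

include hva hvγ hvw in
/-- Gluing: the last vertex lies on `{v, w₀}`. -/
theorem glue_getLast_mem : ∀ y, (γ.verts ++ η.verts).getLast? = some y → y ∈ s(v, w₀) := by
  intro y hy
  rw [List.getLast?_append] at hy
  rcases h : η.verts.getLast? with _ | t
  · rw [h, Option.none_or, arrival_getLast?_eq hva γ hvγ, Option.some.injEq] at hy
    rw [← hy, ← eq_of_cont_eq_nil γ hvw η (List.getLast?_eq_none_iff.1 h)]
    exact Sym2.mem_mk_right v w
  · rw [h, Option.some_or] at hy
    exact η.getLast_mem y (h.trans hy)

include hva in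
/-- Gluing: the vertex list is nonempty. -/
theorem glue_ne_nil : γ.verts ++ η.verts ≠ [] := by
  simp [arrival_verts_ne_nil hva γ]

include hva hvγ hvw in
/-- Gluing: no edge or half-edge is used twice. The edge list of the glued walk is
`a, steps of γ` followed by the edge list `{w,v}, steps of η, {v,w₀}` of the continuation; the
two blocks are disjoint since every entry of the second contains `v` or a vertex of `η`, while
`v ∉ a`, `v ∉ γ` and `η` avoids `γ ∋ head γ ∈ a`. -/
theorem glue_edges_nodup :
    (a :: List.zipWith (fun b c => s(b, c)) (γ.verts ++ η.verts) (γ.verts ++ η.verts).tail ++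
      [s(v, w₀)]).Nodup := by
  have hne := arrival_verts_ne_nil hva γ
  have hlast := arrival_getLast?_eq hva γ hvγ
  have hedγ := γ.edges_nodup hne
  rcases eq_or_ne η.verts [] with hη | hηne
  · -- trivial continuation: `w = w₀` and the glued walk is `γ`
    have hw := eq_of_cont_eq_nil γ hvw η hη
    subst hw
    rw [hη, List.append_nil]
    exact hedγ
  obtain ⟨t, ht⟩ := cont_eq_cons γ hva hvγ η hηne
  have hedη := η.edges_nodup hηne
  rw [ht] at hedη
  rw [ht, edges_append_cons, edges_concat hlast]
  set P := List.zipWith (fun b c => s(b, c)) γ.verts γ.verts.tail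
  set Q := List.zipWith (fun b c => s(b, c)) (v :: t) (v :: t).tail
  have e : a :: (P ++ [s(w, v)] ++ Q) ++ [s(v, w₀)] = (a :: P) ++ (s(w, v) :: Q ++ [s(v, w₀)]) := by
    simp
  rw [e, List.nodup_append]
  refine ⟨hedγ.sublist (List.sublist_append_left _ _), hedη, ?_⟩
  rintro e he f hf rfl
  rcases List.mem_cons.1 he with rfl | he
  · -- `e = a`: `v ∉ a`, and a step of `η` equal to `a` would put `head γ ∈ a` on `η`
    rcases List.mem_cons.1 hf with h | hf
    · exact hva (h ▸ Sym2.mem_mk_right w v)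
    rcases List.mem_append.1 hf with hf | hf
    · have h1 : γ.verts.head hne ∈ v :: t :=
        forall_mem_of_mem_edges _ _ hf _ (γ.head_mem _ (List.head?_eq_some_head hne))
      exact (cont_mem γ η _ (by rw [ht]; exact h1)).2 (List.head_mem hne)
    · exact hva ((List.mem_singleton.1 hf) ▸ Sym2.mem_mk_left v w₀)
  · -- `e` is a step of `γ`: its endpoints lie on `γ`, not on `η`, and differ from `v`
    have hin : ∀ c ∈ e, c ∈ γ.verts := forall_mem_of_mem_edges _ _ he
    rcases List.mem_cons.1 hf with h | hf
    · exact hvγ (hin v (h ▸ Sym2.mem_mk_right w v))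
    rcases List.mem_append.1 hf with hf | hf
    · have h1 : e.out.1 ∈ v :: t := forall_mem_of_mem_edges _ _ hf _ (Sym2.out_fst_mem e)
      exact (cont_mem γ η _ (by rw [ht]; exact h1)).2 (hin _ (Sym2.out_fst_mem e))
    · exact hvγ (hin v ((List.mem_singleton.1 hf) ▸ Sym2.mem_mk_left v w₀))

include hva hvγ hvw in
/-- **Multiplicativity of the weight under gluing.** If the walk `ω : a → {v, w₀}` has vertex
list `γ ++ η` (a first arrival `γ` through `w` glued with a continuation `η`), then
`ℓ(ω) = ℓ(γ) + ℓ(η)` and `W(ω) = W(γ) + W(η)` — the last half-segment `c(w) → mid{v,w}` of `γ`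
and the first half-segment `mid{w,v} → c(v)` of `η` are the two halves of the segment
`c(w) → c(v)` of `ω` (a trivial `η` forces `w = w₀` and `ω = γ`) — so
`weight(ω) = weight(γ) · weight(η)`. -/
theorem weight_eq_of_verts_eq_append (ω : HexMidEdgeSAW Λ a s(v, w₀))
    (hω : ω.verts = γ.verts ++ η.verts) (x σ : ℝ) :
    ω.weight x σ = γ.weight x σ * η.weight x σ := by
  have hlen : ω.length = γ.length + η.length := by
    simp [HexMidEdgeSAW.length, hω]
  have hW : ω.winding = γ.winding + η.winding := by
    rcases eq_or_ne η.verts [] with hη | hηne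
    · have hw := eq_of_cont_eq_nil γ hvw η hη
      subst hw
      simp [HexMidEdgeSAW.winding, HexMidEdgeSAW.points, hω, hη]
    obtain ⟨t, ht⟩ := cont_eq_cons γ hva hvγ η hηne
    obtain ⟨L, hL⟩ := List.getLast?_eq_some_iff.1 (arrival_getLast?_eq hva γ hvγ)
    have hmid : hexMidpoint s(v, w) =
        hexCenter w + (1 / 2 : ℝ) * (hexCenter v - hexCenter w) := by
      rw [hexMidpoint_mk]; push_cast; ring
    have hmid' : hexMidpoint s(w, v) =
        hexCenter v + (1 / 2 : ℝ) * (hexCenter w - hexCenter v) := by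
      rw [hexMidpoint_mk]; push_cast; ring
    have e1 : ω.points = (hexMidpoint a :: L.map hexCenter) ++
        hexCenter w :: hexCenter v :: (t.map hexCenter ++ [hexMidpoint s(v, w₀)]) := by
      simp [HexMidEdgeSAW.points, hω, hL, ht]
    have e2 : γ.points =
        (hexMidpoint a :: L.map hexCenter) ++ [hexCenter w, hexMidpoint s(v, w)] := by
      simp [HexMidEdgeSAW.points, hL]
    have e3 : η.points =
        hexMidpoint s(w, v) :: hexCenter v :: (t.map hexCenter ++ [hexMidpoint s(v, w₀)]) := by
      simp [HexMidEdgeSAW.points, ht]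
    rw [HexMidEdgeSAW.winding, HexMidEdgeSAW.winding, HexMidEdgeSAW.winding, e1, e2, e3,
      winding_append_cons_cons, hmid, winding_concat_right_ray (t := 1 / 2) (by norm_num), hmid',
      winding_cons_left_ray (t := 1 / 2) (by norm_num)]
  rw [HexMidEdgeSAW.weight, HexMidEdgeSAW.weight, HexMidEdgeSAW.weight, hW, hlen,
    Complex.ofReal_add, mul_add, Complex.exp_add, pow_add]
  ring

include hva hvγ hvw in
/-- A glued walk (vertex list `γ ++ η`) either avoids `v`, with `w = w₀` (trivial
continuation), or passes `w` right before `v`. -/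
theorem spec_of_verts_eq_append (ω : HexMidEdgeSAW Λ a s(v, w₀))
    (hω : ω.verts = γ.verts ++ η.verts) : (v ∉ ω.verts ∧ w = w₀) ∨ [w, v] <:+: ω.verts := by
  rw [hω]
  rcases eq_or_ne η.verts [] with hη | hηne
  · left
    refine ⟨?_, eq_of_cont_eq_nil γ hvw η hη⟩
    simp [hη, hvγ]
  · right
    obtain ⟨t, ht⟩ := cont_eq_cons γ hva hvγ η hηne
    obtain ⟨L, hL⟩ := List.getLast?_eq_some_iff.1 (arrival_getLast?_eq hva γ hvγ)
    refine ⟨L, t, ?_⟩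
    rw [ht, show γ.verts ++ v :: t = (L ++ [w]) ++ v :: t from congrArg (· ++ v :: t) hL]
    simp

include hva hvγ in
/-- The first arrival is recovered from the glued walk as its longest prefix avoiding `v`. -/
theorem takeWhile_glue :
    (γ.verts ++ η.verts).takeWhile (fun y => !decide (y = v)) = γ.verts := by
  rw [List.takeWhile_append_of_pos (fun y hy => by simpa using ne_of_mem_of_not_mem hy hvγ)]
  rcases eq_or_ne η.verts [] with hη | hηne
  · simp [hη]
  · obtain ⟨t, ht⟩ := cont_eq_cons γ hva hvγ η hηne
    rw [ht, List.takeWhile_cons_of_neg (by simp), List.append_nil]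

end Glue

/-! ### Cutting a walk at its first visit to `v` -/

/-- **Cutting.** A walk `ω` from `a` to `{v, w₀}` that passes `w` right before `v` splits at
(its unique visit to) `v` into a first arrival `γ` at `v` through `w` and a continuation: a walk
of the slit domain `Λ ∖ γ` from the door `{w, v}` to `{v, w₀}`. -/
theorem exists_cut (hv : v ∈ Λ) (hvw : hexGraph.Adj v w) (ω : HexMidEdgeSAW Λ a s(v, w₀))
    (h : [w, v] <:+: ω.verts) :
    ∃ γ : HexMidEdgeSAW Λ a s(v, w), v ∉ γ.verts ∧
      ∃ η : HexMidEdgeSAW (Λ \ γ.verts.toFinset) s(w, v) s(v, w₀),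
        ω.verts = γ.verts ++ η.verts := by
  obtain ⟨s, t, hst⟩ := h
  have hdec : ω.verts = (s ++ [w]) ++ v :: t := by rw [← hst]; simp
  -- vertices
  have hnd := ω.nodup
  rw [hdec] at hnd
  obtain ⟨hnd₁, hnd₂, hdis⟩ := List.nodup_append.1 hnd
  have hvγ : v ∉ s ++ [w] := fun h => hdis v h v List.mem_cons_self rfl
  have hch := ω.isChain
  rw [hdec] at hch
  obtain ⟨hch₁, hch₂, -⟩ := List.isChain_append.1 hch
  -- edges
  have hne : ω.verts ≠ [] := by rw [hdec]; simp
  have hed := ω.edges_nodup hne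
  rw [hdec, edges_append_cons, edges_concat (List.getLast?_concat (l := s) (a := w))] at hed
  set P := List.zipWith (fun b c => s(b, c)) (s ++ [w]) (s ++ [w]).tail
  set Q := List.zipWith (fun b c => s(b, c)) (v :: t) (v :: t).tail
  have e₁ : a :: (P ++ [s(w, v)] ++ Q) ++ [s(v, w₀)] =
      (a :: P ++ [s(w, v)]) ++ (Q ++ [s(v, w₀)]) := by simp
  have e₂ : a :: (P ++ [s(w, v)] ++ Q) ++ [s(v, w₀)] =
      (a :: P) ++ (s(w, v) :: Q ++ [s(v, w₀)]) := by simp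
  have hedγ : (a :: P ++ [s(v, w)]).Nodup := by
    rw [Sym2.eq_swap (a := v) (b := w)]
    exact (e₁ ▸ hed).sublist (List.sublist_append_left _ _)
  have hedη : (s(w, v) :: Q ++ [s(v, w₀)]).Nodup :=
    (e₂ ▸ hed).sublist (List.sublist_append_right _ _)
  refine ⟨⟨s ++ [w], fun y hy => ω.subset y (by rw [hdec]; exact List.mem_append_left _ hy), hnd₁,
      hch₁, fun y hy => ω.head_mem y ?_, fun y hy => ?_, fun h => absurd h (by simp),
      fun _ => hedγ, ω.fst_mem⟩, hvγ,
    ⟨v :: t, fun y hy => Finset.mem_sdiff.2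
        ⟨ω.subset y ?_, fun h => hdis y (List.mem_toFinset.1 h) y hy rfl⟩,
      hnd₂, hch₂, fun y hy => ?_, fun y hy => ω.getLast_mem y ?_,
      fun h => absurd h (List.cons_ne_nil v t),
      fun _ => hedη, door_mem_hexDomainMidEdges hv hvγ hvw⟩, hdec⟩
  · rw [hdec, List.head?_append_of_ne_nil _ (by simp)]; exact hy
  · rw [List.getLast?_concat, Option.some.injEq] at hy
    rw [← hy]; exact Sym2.mem_mk_right v w
  · rw [hdec]; exact List.mem_append_right _ hy
  · rw [List.head?_cons, Option.some.injEq] at hy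
    rw [← hy]; exact Sym2.mem_mk_right w v
  · rw [hdec, List.getLast?_append_of_ne_nil _ (List.cons_ne_nil v t)]; exact hy

/-- A walk from `a ∌ v` containing `v` passes some neighbour `p` of `v` right before `v`. -/
theorem exists_infix_of_mem (hva : v ∉ a) (ω : HexMidEdgeSAW Λ a s(v, w₀)) (hvω : v ∈ ω.verts) :
    ∃ p, hexGraph.Adj v p ∧ [p, v] <:+: ω.verts := by
  obtain ⟨s, t, hst⟩ := List.append_of_mem hvω
  have hs : s ≠ [] := by
    rintro rfl
    exact hva (ω.head_mem v (by rw [hst]; rfl))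
  obtain ⟨s', p, rfl⟩ := (List.eq_nil_or_concat' s).resolve_left hs
  have hdec : ω.verts = s' ++ p :: v :: t := by rw [hst]; simp
  have hch := ω.isChain
  rw [hdec] at hch
  obtain ⟨-, hpv, -⟩ := List.isChain_append_cons_cons.1 hch
  exact ⟨p, hpv.symm, s', t, by rw [hdec]; simp⟩

end PortRenewal

/-- **Registered sub-goal `helper_portRenewalWalks`** (walk surgery for the stub
`stub_portRenewal`): for `v ∈ Λ` off `a` and neighbours `w, w₀` of `v` (possibly equal),
(i) gluing a first arrival `γ` at `v` through `w` with a walk `η` of the slit domain `Λ ∖ γ` from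
the door `{w, v}` to `{v, w₀}` gives a walk of `Λ` from `a` to `{v, w₀}` with vertex list
`γ ++ η` and weight `weight γ · weight η`; (ii) conversely every walk from `a` to `{v, w₀}` passing
`w` right before `v` is such a concatenation. -/
theorem helper_portRenewalWalks :
    ∀ (Λ : Finset HexVertex) (a : Sym2 HexVertex) (v w w₀ : HexVertex), v ∈ Λ → v ∉ a →
      hexGraph.Adj v w → hexGraph.Adj v w₀ →
      (∀ (γ : HexMidEdgeSAW Λ a s(v, w)), v ∉ γ.verts →
        ∀ η : HexMidEdgeSAW (Λ \ γ.verts.toFinset) s(w, v) s(v, w₀),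
          ∃ ω : HexMidEdgeSAW Λ a s(v, w₀), ω.verts = γ.verts ++ η.verts ∧
            ∀ x σ : ℝ, ω.weight x σ = γ.weight x σ * η.weight x σ) ∧
      (∀ ω : HexMidEdgeSAW Λ a s(v, w₀), [w, v] <:+: ω.verts →
        ∃ γ : HexMidEdgeSAW Λ a s(v, w), v ∉ γ.verts ∧
          ∃ η : HexMidEdgeSAW (Λ \ γ.verts.toFinset) s(w, v) s(v, w₀),
            ω.verts = γ.verts ++ η.verts) :=
  fun _Λ _a _v _w _w₀ hv hva hvw _hvw₀ =>
    ⟨fun γ hvγ η =>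
        ⟨⟨γ.verts ++ η.verts, PortRenewal.glue_subset γ η, PortRenewal.glue_nodup γ η,
            PortRenewal.glue_isChain γ hva hvγ hvw η, PortRenewal.glue_head_mem γ hva η,
            PortRenewal.glue_getLast_mem γ hva hvγ hvw η,
            fun h => absurd h (PortRenewal.glue_ne_nil γ hva η),
            fun _ => PortRenewal.glue_edges_nodup γ hva hvγ hvw η, γ.fst_mem⟩,
          rfl, PortRenewal.weight_eq_of_verts_eq_append γ hva hvγ hvw η _ rfl⟩,
      PortRenewal.exists_cut hv hvw⟩

end Summit.CriticalPhenomena.SAWScalingLimit.Theorems.SAWDevelopingMapNoFoldBound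

end
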